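import Summits.CriticalPhenomena.Ising3DConformalLimit.Theorems.LeeYangGapNearCriticalLeeYangGapCubeGapFunnel
import Summits.CriticalPhenomena.Ising3DConformalLimit.Theorems.LeeYangGapFirstZeroAntitoneInBeta
import Summits.CriticalPhenomena.Ising3DConformalLimit.Theorems.LeeYangGapMonotonicityTransfer

/-!
# Near-critical Lee–Yang gap — everything happens at `β_c`: the critical cube gap (CG_c)

Route `LeeYangGap` (Ising3DConformalLimit), crux `NearCriticalLeeYangGap` (GAP, item
stmt-CriticalPhenomena-4945), line `registered`, lead c5. The line's funnel (file
`LeeYangGapNearCriticalLeeYangGapCubeGapFunnel.lean`) is the **cube gap**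

  (CG)   `∃ C, ∃ᶠ L, ∃ β ∈ [0, β_c(3)], α₁(Λ_L,β)² · Σ_L ≤ C`,

`α₁(Λ_L,β) = JiangNewman.firstZero 3 (box 3 L) β` the first Lee–Yang zero of the FREE CUBE (first zero
of `θ ↦ Z^free_{Λ_L,β}(iθ)`), `Σ_L = ⟨M_L²⟩_{β_c}` the critical infinite-volume block variance. This file
records, kernel-checked, that the temperature `β ≤ β_c` in (CG) — and in GAP itself — is spurious: by the
Camia–Jiang–Newman antitonicity of the first zero in `β` (route item 4947 `FirstZeroAntitoneInBeta`,
PROVED, `firstZeroAntitoneInBeta_proof`; and its infinite-volume transfer 4948 `MonotonicityTransfer`,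
PROVED, `monotonicityTransfer_proof`) every zero produced at `β ≤ β_c` moves DOWN to `β_c`, so

* `firstZero_box_antitone_beta` : `α₁(Λ_L,β') ≤ α₁(Λ_L,β)` for `0 ≤ β ≤ β'` (CJN 2023 Thm 2 / Cor 1
  for the classical partition-function zeros of the free cube, through the dictionary
  `Z_{Λ,β,it} = Z_{Λ,β,0}·⟨cos tM_Λ⟩^free_{Λ;β,0}`);
* `cubeGap_iff_criticalCubeGap` : (CG) ↔ (CG_c), where

  (CG_c)  `∃ C, ∃ᶠ L, α₁(Λ_L,β_c)² · Σ_L ≤ C`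

  — the first partition-function zero of the CRITICAL free cube is `O(Σ_L^{-1/2})` along a sequence of
  `L` (the lower half of the Itzykson–Pearson–Zuber finite-size scaling `h₁(L) ≍ L^{-y_h}`,
  `Σ_L ≍ L^{2y_h}`, `2y_h = 5 − η`, stated with amplitudes and no exponents);
* `nearCriticalLeeYangGap_iff_criticalBlockGap` : GAP ↔ (GAP_c), its `β = β_c` instance
  (`∃ C, ∃ᶠ L, ∃ θ > 0, θ²Σ_L ≤ C ∧ ⟨cos θM_L⟩_{β_c} = 0`);
* `criticalBlockGap_of_criticalCubeGap` : (CG_c) → (GAP_c) and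
  `stub_gapOfCriticalCubeGap` / `nearCriticalLeeYangGap_of_criticalCubeGap` : (CG_c) → GAP (landed
  transfer `stub_gapOfCubeGap`).

PLANNER NOTE (lead c5). If the two open stubs of line `registered` (S1r `stub_firstZeroRate`, S2χ₁
`stub_susceptibilityComparabilityOneScale`) are promoted, the lean promotion is the SINGLE child (CG_c)
(exact Lean statement: the antecedent of `stub_gapOfCriticalCubeGap` below, registered on the item): one
temperature, one observable (the classical Lee–Yang zeros of the critical free cube), assembly = this
file. The near-critical detour EDGE + S1r + S2χ₁ only serves to prove (CG) = (CG_c) and is jointly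
stronger (companion file `…FirstZeroRateAnatomy.lean`: S1r alone forces the reverse edge-hyperscaling
bound `α₁(Λ_n,β)²ξ³χ ≥ c`).

## References

* F. Camia, J. Jiang, C. M. Newman, CMP 401 (2023) 2459–2482, arXiv:2207.12247, Thm 2 / Cor 1
  [CamiaJiangNewman2023].
* J. Jiang, C. M. Newman, CPAM 77 (2024) 1224–1234, §1 eq. (1.3), §2 [JiangNewman2023].
* C. Itzykson, R. B. Pearson, J. B. Zuber, Nucl. Phys. B220 (1983) 415–433 [ItzyksonPearsonZuber1983].
* C. M. Newman, CMP 41 (1975) 1–9 [Newman1975].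
-/

noncomputable section

namespace Summit.CriticalPhenomena.Ising3DConformalLimit.LeeYangGapNearCriticalLeeYangGap

open Filter Complex
open Literature.Probability.LatticeModels
open Summit.CriticalPhenomena.Ising3DConformalLimit.Theses.LeeYangGap (NearCriticalLeeYangGap)

/-! ### The dictionary `⟨cos tM_Λ⟩^free = 0 ↔ Z_{Λ,β,it} = 0` and antitonicity in `β` -/

/-- A real zero of the free finite-volume block characteristic function of the WHOLE volume is a
Lee–Yang zero of Jiang–Newman's partition function: `⟨cos(t M_Λ)⟩^free_{Λ;β,0} = 0 ⟹ Z_{Λ,β,it} = 0`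
(`Re Z_{Λ,β,it} = Σ_τ w(τ) cos(t M_Λ(τ)) = Z_{Λ,β,0}·⟨cos tM_Λ⟩^free`, `Im Z_{Λ,β,it} = 0`). -/
theorem partitionFunction_mul_I_eq_zero_of_isingExpect_cos (Λ : Finset (Site 3)) (β t : ℝ)
    (h : isingExpect (zdGraph 3) Λ β 0 .free (fun σ => Real.cos (t * ∑ x ∈ Λ, spinAt x σ)) = 0) :
    JiangNewman.partitionFunction 3 Λ β (t * I) = 0 := by
  have hmeas : Measurable fun σ : SpinConfig (Site 3) => Real.cos (t * ∑ x ∈ Λ, spinAt x σ) :=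
    Real.measurable_cos.comp ((Finset.measurable_sum _ fun x _ => measurable_spinAt x).const_mul _)
  rw [JiangNewman.isingExpect_zero_field_eq Λ β hmeas] at h
  have hden : 0 < ∑ τ : Λ → ℤˣ,
      Real.exp (β * ∑ e ∈ edgesIn (zdGraph 3) Λ, bondSpin (glue Λ τ .free) e) :=
    Finset.sum_pos (fun _ _ => Real.exp_pos _) Finset.univ_nonempty
  have hnum : ∑ τ : Λ → ℤˣ,
      Real.exp (β * ∑ e ∈ edgesIn (zdGraph 3) Λ, bondSpin (glue Λ τ .free) e) *
        Real.cos (t * ∑ x ∈ Λ, spinAt x (glue Λ τ .free)) = 0 := by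
    rcases div_eq_zero_iff.1 h with h0 | h0
    · exact h0
    · exact absurd h0 hden.ne'
  apply Complex.ext
  · rw [JiangNewman.partitionFunction_mul_I_re, hnum, Complex.zero_re]
  · rw [JiangNewman.partitionFunction_mul_I_im, Complex.zero_im]

/-- **The first Lee–Yang zero of the free cube is antitone in `β`** (Camia–Jiang–Newman 2023, Thm 2 /
Cor 1, for the classical partition-function zeros): `α₁(Λ_L,β') ≤ α₁(Λ_L,β)` for `0 ≤ β ≤ β'`.
Proof: `α₁(Λ_L,β) > 0` is a zero of `⟨cos θM_L⟩^free_{Λ_L;β,0}` (`stub_firstZeroAttained`); the PROVED route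
item `FirstZeroAntitoneInBeta` (`firstZeroAntitoneInBeta_proof`, with `M = L`) yields a zero `θ' ≤ α₁(Λ_L,β)`
of `⟨cos θ'M_L⟩^free_{Λ_L;β',0}`, which is a zero of `Z_{Λ_L,β',iθ'}`, whence `α₁(Λ_L,β') ≤ θ'`
(`JiangNewman.firstZero_le_of_zero`). -/
theorem firstZero_box_antitone_beta (L : ℕ) {β β' : ℝ} (hβ : 0 ≤ β) (hββ' : β ≤ β') :
    JiangNewman.firstZero 3 (box 3 L) β' ≤ JiangNewman.firstZero 3 (box 3 L) β := by
  obtain ⟨hpos, hzero⟩ := stub_firstZeroAttained L β hβ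
  obtain ⟨θ', hθ'pos, hθ'le, hzero'⟩ :=
    Summit.CriticalPhenomena.Ising3DConformalLimit.Theorems.firstZeroAntitoneInBeta_proof
      L L β β' _ le_rfl hβ hββ' hpos hzero
  exact (JiangNewman.firstZero_le_of_zero (box 3 L) β' hθ'pos
    (partitionFunction_mul_I_eq_zero_of_isingExpect_cos (box 3 L) β' θ' hzero')).trans hθ'le

/-! ### (CG) ↔ (CG_c): the cube gap is a statement at `β_c` -/

/-- **(CG) → (CG_c)**: a cube gap at some `β ≤ β_c(3)` is a cube gap AT `β_c(3)` with the same constant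
(`α₁(Λ_L,β_c) ≤ α₁(Λ_L,β)` by `firstZero_box_antitone_beta`, and `Σ_L > 0`). -/
theorem criticalCubeGap_of_cubeGap
    (h : ∃ C : ℝ, ∃ᶠ L : ℕ in atTop, ∃ β : ℝ, 0 ≤ β ∧ β ≤ criticalBeta 3 ∧
      JiangNewman.firstZero 3 (box 3 L) β ^ 2 *
        plusExpect 3 (criticalBeta 3) 0 (fun σ => (∑ x ∈ box 3 L, spinAt x σ) ^ 2) ≤ C) :
    ∃ C : ℝ, ∃ᶠ L : ℕ in atTop,
      JiangNewman.firstZero 3 (box 3 L) (criticalBeta 3) ^ 2 *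
        plusExpect 3 (criticalBeta 3) 0 (fun σ => (∑ x ∈ box 3 L, spinAt x σ) ^ 2) ≤ C := by
  obtain ⟨C, hfreq⟩ := h
  refine ⟨C, hfreq.mono fun L hL => ?_⟩
  obtain ⟨β, h0β, hββc, hC⟩ := hL
  refine le_trans (mul_le_mul_of_nonneg_right ?_
    (PerfectScreeningCoulombImpliesNontrivial.sketchPub_blockVariance_pos L).le) hC
  exact pow_le_pow_left₀ (JiangNewman.firstZero_nonneg 3 _ _)
    (firstZero_box_antitone_beta L h0β hββc) 2

/-- **(CG_c) → (CG)**: take `β := β_c(3)` (`0 ≤ β_c`, `criticalBeta_nonneg`). -/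
theorem cubeGap_of_criticalCubeGap
    (h : ∃ C : ℝ, ∃ᶠ L : ℕ in atTop,
      JiangNewman.firstZero 3 (box 3 L) (criticalBeta 3) ^ 2 *
        plusExpect 3 (criticalBeta 3) 0 (fun σ => (∑ x ∈ box 3 L, spinAt x σ) ^ 2) ≤ C) :
    ∃ C : ℝ, ∃ᶠ L : ℕ in atTop, ∃ β : ℝ, 0 ≤ β ∧ β ≤ criticalBeta 3 ∧
      JiangNewman.firstZero 3 (box 3 L) β ^ 2 *
        plusExpect 3 (criticalBeta 3) 0 (fun σ => (∑ x ∈ box 3 L, spinAt x σ) ^ 2) ≤ C := by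
  obtain ⟨C, hfreq⟩ := h
  exact ⟨C, hfreq.mono fun L hL => ⟨criticalBeta 3, criticalBeta_nonneg 3, le_rfl, hL⟩⟩

/-- **(CG) ↔ (CG_c)**: the cube gap of line `registered` is exactly the statement that the first
partition-function zero of the CRITICAL free cube is `O(Σ_L^{-1/2})` along a sequence of `L`. -/
theorem cubeGap_iff_criticalCubeGap :
    (∃ C : ℝ, ∃ᶠ L : ℕ in atTop, ∃ β : ℝ, 0 ≤ β ∧ β ≤ criticalBeta 3 ∧
      JiangNewman.firstZero 3 (box 3 L) β ^ 2 *
        plusExpect 3 (criticalBeta 3) 0 (fun σ => (∑ x ∈ box 3 L, spinAt x σ) ^ 2) ≤ C) ↔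
    (∃ C : ℝ, ∃ᶠ L : ℕ in atTop,
      JiangNewman.firstZero 3 (box 3 L) (criticalBeta 3) ^ 2 *
        plusExpect 3 (criticalBeta 3) 0 (fun σ => (∑ x ∈ box 3 L, spinAt x σ) ^ 2) ≤ C) :=
  ⟨criticalCubeGap_of_cubeGap, cubeGap_of_criticalCubeGap⟩

/-! ### GAP ↔ (GAP_c): the crux is a statement at `β_c` -/

/-- **GAP ↔ (GAP_c)**: `NearCriticalLeeYangGap` (a zero at SOME `β ∈ [0, β_c]` against `Σ_L`) is
equivalent to its `β = β_c` instance — for infinitely many `L` the critical block characteristic function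
`θ ↦ ⟨cos θM_L⟩_{β_c}` has a zero `θ > 0` with `θ²Σ_L ≤ C` (→: the PROVED items 4947 + 4948,
`monotonicityTransfer_proof firstZeroAntitoneInBeta_proof`, move the zero down to `β_c`; ←: `β := β_c`). -/
theorem nearCriticalLeeYangGap_iff_criticalBlockGap :
    NearCriticalLeeYangGap ↔
    ∃ C : ℝ, ∃ᶠ L : ℕ in atTop, ∃ θ : ℝ, 0 < θ ∧
      θ ^ 2 * plusExpect 3 (criticalBeta 3) 0 (fun σ => (∑ x ∈ box 3 L, spinAt x σ) ^ 2) ≤ C ∧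
      plusExpect 3 (criticalBeta 3) 0
        (fun σ => Real.cos (θ * ∑ x ∈ box 3 L, spinAt x σ)) = 0 := by
  constructor
  · rintro ⟨C, hfreq⟩
    have hmono := Summit.CriticalPhenomena.Ising3DConformalLimit.Theorems.monotonicityTransfer_proof
      Summit.CriticalPhenomena.Ising3DConformalLimit.Theorems.firstZeroAntitoneInBeta_proof
    refine ⟨C, hfreq.mono fun L hL => ?_⟩
    obtain ⟨β, θ, h0β, hββc, hθ, hθC, hzero⟩ := hL
    obtain ⟨θ', hθ'pos, hθ'le, hzero'⟩ := hmono L β (criticalBeta 3) θ h0β hββc le_rfl hθ hzero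
    refine ⟨θ', hθ'pos, le_trans (mul_le_mul_of_nonneg_right ?_
      (PerfectScreeningCoulombImpliesNontrivial.sketchPub_blockVariance_pos L).le) hθC, hzero'⟩
    exact pow_le_pow_left₀ hθ'pos.le hθ'le 2
  · rintro ⟨C, hfreq⟩
    refine ⟨C, hfreq.mono fun L hL => ?_⟩
    obtain ⟨θ, hθ, hθC, hzero⟩ := hL
    exact ⟨criticalBeta 3, θ, criticalBeta_nonneg 3, le_rfl, hθ, hθC, hzero⟩

/-! ### (CG_c) → (GAP_c) → GAP -/

/-- **(CG_c) → (GAP_c)**: a critical cube gap gives a critical block gap with the same constant — the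
critical free cube's first zero `α₁(Λ_L,β_c)` bounds from above a zero of the critical infinite-volume
block characteristic function (`exists_blockZero_sq_mul_le_of_cubeZero` at `β = β_c`: S1a, S1v = CJN in
the volume, S1t = limit passage). -/
theorem criticalBlockGap_of_criticalCubeGap
    (h : ∃ C : ℝ, ∃ᶠ L : ℕ in atTop,
      JiangNewman.firstZero 3 (box 3 L) (criticalBeta 3) ^ 2 *
        plusExpect 3 (criticalBeta 3) 0 (fun σ => (∑ x ∈ box 3 L, spinAt x σ) ^ 2) ≤ C) :
    ∃ C : ℝ, ∃ᶠ L : ℕ in atTop, ∃ θ : ℝ, 0 < θ ∧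
      θ ^ 2 * plusExpect 3 (criticalBeta 3) 0 (fun σ => (∑ x ∈ box 3 L, spinAt x σ) ^ 2) ≤ C ∧
      plusExpect 3 (criticalBeta 3) 0
        (fun σ => Real.cos (θ * ∑ x ∈ box 3 L, spinAt x σ)) = 0 := by
  obtain ⟨C, hfreq⟩ := h
  refine ⟨C, hfreq.mono fun L hL => ?_⟩
  obtain ⟨θ', hθ'pos, hle, hzero⟩ :=
    exists_blockZero_sq_mul_le_of_cubeZero (criticalBeta_nonneg 3) le_rfl hL
  exact ⟨θ', hθ'pos, hle, hzero⟩

/-- **`stub_gapOfCriticalCubeGap` — (CG_c) → GAP, the single-temperature child of crux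
stmt-CriticalPhenomena-4945** (registered glue stub of line `registered`, verbatim). If for infinitely
many `L` the first Lee–Yang zero of the critical free cube satisfies `α₁(Λ_L,β_c)²·Σ_L ≤ C`
(`Σ_L = ⟨M_L²⟩_{β_c}` the critical infinite-volume block variance), then `NearCriticalLeeYangGap` holds
(with the same `C`, at `β = β_c`). One line from the landed transfer `stub_gapOfCubeGap`. -/
theorem stub_gapOfCriticalCubeGap :
    (∃ C : ℝ, ∃ᶠ L : ℕ in Filter.atTop,
      Literature.Probability.LatticeModels.JiangNewman.firstZero 3
          (Literature.Probability.LatticeModels.box 3 L)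
          (Literature.Probability.LatticeModels.criticalBeta 3) ^ 2 *
        Literature.Probability.LatticeModels.plusExpect 3
          (Literature.Probability.LatticeModels.criticalBeta 3) 0
          (fun σ => (∑ x ∈ Literature.Probability.LatticeModels.box 3 L,
            Literature.Probability.LatticeModels.spinAt x σ) ^ 2) ≤ C) →
    Summit.CriticalPhenomena.Ising3DConformalLimit.Theses.LeeYangGap.NearCriticalLeeYangGap :=
  fun h => stub_gapOfCubeGap (cubeGap_of_criticalCubeGap h)

/-- (CG_c) → GAP with a named hypothesis (`stub_gapOfCriticalCubeGap`). -/
theorem nearCriticalLeeYangGap_of_criticalCubeGap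
    (h : ∃ C : ℝ, ∃ᶠ L : ℕ in atTop,
      JiangNewman.firstZero 3 (box 3 L) (criticalBeta 3) ^ 2 *
        plusExpect 3 (criticalBeta 3) 0 (fun σ => (∑ x ∈ box 3 L, spinAt x σ) ^ 2) ≤ C) :
    NearCriticalLeeYangGap :=
  stub_gapOfCriticalCubeGap h

end Summit.CriticalPhenomena.Ising3DConformalLimit.LeeYangGapNearCriticalLeeYangGap

end
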